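import Literature.NumberTheory.EllipticCurves.CongruentNumberEvenFiveSelmerBoundSevenModEight
import HarnessLib

/-!
# `#Sel⁽²⁾(E_{2pq}/ℚ) ≤ 8` for primes `p ≡ 1 (mod 8)`, `q ≡ 3 (mod 4)`, `(p/q) = −1` — the loud `p ≡ 1 (mod 8)` cells of
# the `k = 2` rung — by complete `2`-descent

Topic `NumberTheory/EllipticCurves`; namespace
`Literature.NumberTheory.EllipticCurves.CongruentNumberTwicePrimePairSelmer` (continued from
`CongruentNumberEvenFiveSelmerBound{,ThreeModEight,SevenModEight}.lean`, whose sign-agnostic local bookkeeping and the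
`2`-adic relation of `TwoDescentKummerBridgeDyadicCN.lean` are reused). The `k = 2` rung of Monsky's even law
(`P2/Conjectures/CongruentNumberEvenMonskyLawAtTwo`: `n = 2pq ≡ 6 (mod 8)`, `s(n) = 1`) consists of the even-five cells
(`p ≡ 5 (mod 8)`, any symbol — `#Sel₂ ≤ 8` there is `card_selmerGroup_two_le_eight_congruentNumberCurve_two_mul_five_mul`) and the
cells `p ≡ 1 (mod 8)`, `q ≡ 3 (mod 4)`, `(p/q) = (q/p) = −1` (for `(p/q) = +1` one has `s = 3`). On the latter, with
`(2/p) = (−1/p) = +1`, `(q/p) = −1`, `(−1/q) = −1`: for `q ≡ 3 (mod 8)` the places `p`, `q` give the four independent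
relations `a_q = a_p`, `b_q = b_p`, `a₂ + a_p = b_q`, `s + b₂ + b_p = a_q + b_q`; for `q ≡ 7 (mod 8)` they give
`a_q = a_p`, `b_q = b_p`, `s + b_p = a_q` and the `2`-adic relation `a₂ = s + b_q + b₂` is the fourth. Hence
**`#Sel⁽²⁾(E_{2pq}/ℚ) ≤ 8` for all primes `p ≡ 1 (mod 8)`, `q ≡ 3 (mod 4)` with `(p/q) = −1`**
(`card_selmerGroup_two_le_eight_congruentNumberCurve_two_mul_one_mod_eight_of_jacobiSym_eq_neg_one`) — in print Monsky's
appendix to Heath-Brown 1994 / Aoki 1999 Thm. 2.2 (`#Sel₂ = 8`). Pure proof file; everything is proved; no named facts.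

## References

* [SilvermanAEC2009] J. H. Silverman, *The Arithmetic of Elliptic Curves*, 2nd ed., GTM 106,
  Springer 2009, Prop. X.1.4, Example X.1.5, Prop. X.4.9, Example X.4.10.
* [Monsky1990MockHeegner] P. Monsky, *Mock Heegner points and congruent numbers*, Math. Z. 204
  (1990) 45–68, p. 67 Remark (3); appendix to Heath-Brown 1994 (`s(n)` formula).
-/

noncomputable section

open scoped Classical

open WeierstrassCurve WeierstrassCurve.Affine WeierstrassCurve.Affine.Point
open Literature.NumberTheory.GaloisRepresentations
open Literature.NumberTheory.EllipticCurves.KramerTwoDescent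
open Literature.NumberTheory.EllipticCurves.TwoDescentLocal
open IsDedekindDomain NumberField Rat.HeightOneSpectrum

namespace Literature.NumberTheory.EllipticCurves

namespace CongruentNumberTwicePrimePairSelmer

variable {p q : ℕ} [hp : Fact p.Prime] [hq : Fact q.Prime]

/-! ## Small arithmetic helpers (private copies, as in the parent file) -/

/-- `2pq ≠ 0`. [folklore] -/
private theorem two_mul_ne_zero' : 2 * (p * q) ≠ 0 :=
  mul_ne_zero two_ne_zero (mul_ne_zero hp.out.ne_zero hq.out.ne_zero)

/-- `(q : ℤ)` and `p` are coprime for distinct primes. [folklore] -/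
private theorem gcd_q_p' (hpq : p ≠ q) : (q : ℤ).gcd p = 1 := by
  rw [Int.gcd_natCast_natCast]; exact (Nat.coprime_primes hq.out hp.out).mpr (Ne.symm hpq)

omit hq in
/-- `(2 : ℤ)` and an odd prime `p` are coprime. [folklore] -/
private theorem gcd_two_p' (hp2 : p ≠ 2) : (2 : ℤ).gcd p = 1 := by
  rw [show (2 : ℤ) = ((2 : ℕ) : ℤ) from rfl, Int.gcd_natCast_natCast]
  exact (Nat.coprime_primes Nat.prime_two hp.out).mpr (Ne.symm hp2)

omit hp hq in
/-- `(2/p) = −1` for `p ≡ 3` or `5 (mod 8)`. [folklore] -/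
private theorem jac_two_eq_neg_one (h8 : p % 8 = 3 ∨ p % 8 = 5) : jacobiSym 2 p = -1 := by
  rw [jacobiSym.at_two (Nat.odd_iff.mpr (by omega)), ZMod.χ₈_nat_eq_if_mod_eight]
  have h2 : p % 2 ≠ 0 := by omega
  have h17 : ¬ (p % 8 = 1 ∨ p % 8 = 7) := by omega
  simp only [h2, if_false, h17]

omit hp hq in
/-- `(2/p) = 1` for `p ≡ 1` or `7 (mod 8)`. [folklore] -/
private theorem jac_two_eq_one (h8 : p % 8 = 1 ∨ p % 8 = 7) : jacobiSym 2 p = 1 := by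
  rw [jacobiSym.at_two (Nat.odd_iff.mpr (by omega)), ZMod.χ₈_nat_eq_if_mod_eight]
  have h2 : p % 2 ≠ 0 := by omega
  have h17 : (p % 8 = 1 ∨ p % 8 = 7) := h8
  simp only [h2, if_false, h17, if_true]

omit hp hq in
/-- `(−1/p) = 1` for `p ≡ 1 (mod 4)`. [folklore] -/
private theorem jac_neg_one_of_one_mod_four (h4 : p % 4 = 1) : jacobiSym (-1) p = 1 := by
  rw [jacobiSym.at_neg_one (Nat.odd_iff.mpr (by omega)), ZMod.χ₄_nat_eq_if_mod_four]
  have h2 : p % 2 ≠ 0 := by omega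
  simp only [h2, if_false, h4, if_true]

omit hp hq in
/-- `(−1/q) = −1` for `q ≡ 3 (mod 4)`. [folklore] -/
private theorem jac_neg_one_of_three_mod_four' (h4 : p % 4 = 3) : jacobiSym (-1) p = -1 := by
  rw [jacobiSym.at_neg_one (Nat.odd_iff.mpr (by omega)), ZMod.χ₄_nat_eq_if_mod_four]
  have h2 : p % 2 ≠ 0 := by omega
  have h41 : p % 4 ≠ 1 := by omega
  simp only [h2, if_false, h41]

variable [hE : (congruentNumberCurve (2 * (p * q))).IsElliptic]
variable (hT : (congruentNumberCurve (2 * (p * q))).toAffine.SplitTwoTorsion (-((2 * (p * q) : ℕ) : ℚ)) 0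
  ((2 * (p * q) : ℕ) : ℚ))

/-! ## The four linear relations on the cell `p ≡ 1 (mod 8)`, `q ≡ 3 (mod 8)`, `(p/q) = −1` -/

set_option synthInstance.maxSize 100000 in
set_option synthInstance.maxHeartbeats 400000 in
/-- **The four relations annihilate the coordinates**: `a_q = a_p`, `b_q = b_p`, `a₂ + a_p = b_q`, `s + b₂ + b_p = a_q + b_q`.
[folklore] -/
private theorem rows_one3 (a2 ap aq s b2 bp bq : ZMod 2) (P1 : aq = ap) (P2 : bq = bp)
    (Q1 : a2 + ap = bq) (Q2 : s + (b2 + bp) = aq + bq) :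
    (Matrix.mulVecLin (!![0, 1, 1, 0, 0, 0, 0; 0, 0, 0, 0, 0, 1, 1; 1, 1, 0, 0, 0, 0, 1;
      0, 0, 1, 1, 1, 1, 1] : Matrix (Fin 4) (Fin 7) (ZMod 2))).toAddMonoidHom ![a2, ap, aq, s, b2, bp, bq] = 0 := by
  revert P1 P2 Q1 Q2 a2 ap aq s b2 bp bq
  decide

/-- An explicit preimage: the matrix of the four relations is onto `(ℤ/2)⁴`. [folklore] -/
private theorem κ_one3_apply_pivot : ∀ (w : Fin 4 → ZMod 2),
    (Matrix.mulVecLin (!![0, 1, 1, 0, 0, 0, 0; 0, 0, 0, 0, 0, 1, 1; 1, 1, 0, 0, 0, 0, 1;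
      0, 0, 1, 1, 1, 1, 1] : Matrix (Fin 4) (Fin 7) (ZMod 2))).toAddMonoidHom
        ![w 2 + w 1, 0, w 0, w 3 + w 0 + w 1, 0, 0, w 1] = w := by
  decide

omit hp hq in
/-- The matrix of the four relations is surjective. [folklore] -/
private theorem κ_one3_surjective : Function.Surjective
    (Matrix.mulVecLin (!![0, 1, 1, 0, 0, 0, 0; 0, 0, 0, 0, 0, 1, 1; 1, 1, 0, 0, 0, 0, 1;
      0, 0, 1, 1, 1, 1, 1] : Matrix (Fin 4) (Fin 7) (ZMod 2))).toAddMonoidHom := fun w =>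
  ⟨![w 2 + w 1, 0, w 0, w 3 + w 0 + w 1, 0, 0, w 1], κ_one3_apply_pivot w⟩

/-! ## The descent on Selmer classes, `p ≡ 1 (mod 8)`, `q ≡ 3 (mod 8)`, `(p/q) = −1` -/

/-- **The four relations hold on `Sel⁽²⁾(E_{2pq}/ℚ)`** for `p ≡ 1 (mod 8)`, `q ≡ 3 (mod 8)`, `(p/q) = −1` (places `p`,
`q` only). [cite: SilvermanAEC2009, Example X.1.5] [cite: SilvermanAEC2009, Prop. X.1.4, Prop. X.4.9] -/
theorem kill_selmer_one3 (h8p : p % 8 = 1) (h8q : q % 8 = 3) (hsym : jacobiSym p q = -1)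
    {c : galH1Torsion (congruentNumberCurve (2 * (p * q))) 2}
    (hc : c ∈ (congruentNumberCurve (2 * (p * q))).selmerGroup 2) (a b : ℚˣ)
    (ha : kummerEquiv ℚ 2 ((congruentNumberCurve (2 * (p * q))).twoTorsionCharH1 hT c) =
      Additive.ofMul (QuotientGroup.mk a))
    (hb : kummerEquiv ℚ 2 ((congruentNumberCurve (2 * (p * q))).twoTorsionCharH1 hT.swap₁₂ c) =
      Additive.ofMul (QuotientGroup.mk b))
    :
    (Matrix.mulVecLin (!![0, 1, 1, 0, 0, 0, 0; 0, 0, 0, 0, 0, 1, 1; 1, 1, 0, 0, 0, 0, 1;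
      0, 0, 1, 1, 1, 1, 1] : Matrix (Fin 4) (Fin 7) (ZMod 2))).toAddMonoidHom
      ![parityBit 2 (a : ℚ), parityBit p (a : ℚ), parityBit q (a : ℚ), signBit (b : ℚ), parityBit 2 (b : ℚ),
        parityBit p (b : ℚ), parityBit q (b : ℚ)] = 0 := by
  have h4q : q % 4 = 3 := by omega
  have hp2 : p ≠ 2 := by rintro rfl; norm_num at h8p
  have hq2 : q ≠ 2 := by rintro rfl; norm_num at h4q
  have hpq : p ≠ q := by rintro rfl; omega
  have hqp : q ≠ p := Ne.symm hpq
  have hpr : p.Prime := hp.out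
  have hqr : q.Prime := hq.out
  have hp0 : (p : ℚ) ≠ 0 := Nat.cast_ne_zero.mpr hpr.ne_zero
  have hq0 : (q : ℚ) ≠ 0 := Nat.cast_ne_zero.mpr hqr.ne_zero
  have ha0 : (a : ℚ) ≠ 0 := a.ne_zero
  have hb0 : (b : ℚ) ≠ 0 := b.ne_zero
  -- the symbols: `(2/p) = +1`, `(−1/p) = 1`, `(2/q) = −1`, `(−1/q) = −1`, `(q/p) = (p/q) = −1`
  have jP2 := jac_two_eq_one (p := p) (Or.inl h8p)
  have jQ2 := jac_two_eq_neg_one (p := q) (Or.inl h8q)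
  have jPm1 := jac_neg_one_of_one_mod_four (p := p) (by omega)
  have jQm1 := jac_neg_one_of_three_mod_four' (p := q) h4q
  have gqp := gcd_q_p' (p := p) (q := q) hpq
  have gpq := gcd_q_p' (p := q) (q := p) hqp
  have jP4 : jacobiSym ((2 : ℤ) ^ 2) p = 1 := jacobiSym.sq_one' (gcd_two_p' (p := p) hp2)
  have jQ4 : jacobiSym ((2 : ℤ) ^ 2) q = 1 := jacobiSym.sq_one' (gcd_two_p' (p := q) hq2)
  have jPqq : jacobiSym ((q : ℤ) ^ 2) p = 1 := jacobiSym.sq_one' gqp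
  have jQpp : jacobiSym ((p : ℤ) ^ 2) q = 1 := jacobiSym.sq_one' gpq
  have hQR : jacobiSym (p : ℤ) q = jacobiSym (q : ℤ) p :=
    jacobiSym.quadratic_reciprocity_one_mod_four (by omega) (Nat.odd_iff.mpr (by omega))
  have jPq : jacobiSym (q : ℤ) p = -1 := hQR ▸ hsym
  -- values of `qrBit` on the symbols
  have cPm1 : qrBit p ((-1 : ℚ)) = 0 := qrBit_eq_zero_of_eq (p := p) 0 (-1) (by norm_num) jPm1
  have cP2 : qrBit p (((2 : ℕ) : ℚ)) = 0 := qrBit_eq_zero_of_eq (p := p) 0 (2) (by norm_num) jP2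
  have cPq : qrBit p ((q : ℕ) : ℚ) = 1 := qrBit_eq_one_of_eq (p := p) 0 (q) (by norm_num) jPq
  have cQm1 : qrBit q ((-1 : ℚ)) = 1 := qrBit_eq_one_of_eq (p := q) 0 (-1) (by norm_num) jQm1
  have cQ2 : qrBit q (((2 : ℕ) : ℚ)) = 1 := qrBit_eq_one_of_eq (p := q) 0 (2) (by norm_num) jQ2
  have cQp : qrBit q ((p : ℕ) : ℚ) = 1 := qrBit_eq_one_of_eq (p := q) 0 (p) (by norm_num) hsym
  -- the constants at `p`
  have kP0 : qrBit p ((-((2 * (p * q) : ℕ) : ℚ) - 0) * (-((2 * (p * q) : ℕ) : ℚ) - ((2 * (p * q) : ℕ) : ℚ))) = 0 :=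
    qrBit_eq_zero_of_eq (p := p) 2 (2 * 2 ^ 2 * q ^ 2) (by push_cast; ring)
      (by rw [jacobiSym.mul_left, jacobiSym.mul_left, jP2, jP4, jPqq]; norm_num)
  have kP1 : qrBit p (-((2 * (p * q) : ℕ) : ℚ) - 0) = 1 :=
    qrBit_eq_one_of_eq (p := p) 1 (-1 * 2 * q) (by push_cast; ring)
      (by rw [jacobiSym.mul_left, jacobiSym.mul_left, jPm1, jP2, jPq]; norm_num)
  have kP2 : qrBit p ((0 : ℚ) - -((2 * (p * q) : ℕ) : ℚ)) = 1 :=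
    qrBit_eq_one_of_eq (p := p) 1 (2 * q) (by push_cast; ring)
      (by rw [jacobiSym.mul_left, jP2, jPq]; norm_num)
  have kP3 : qrBit p (((0 : ℚ) - -((2 * (p * q) : ℕ) : ℚ)) * (0 - ((2 * (p * q) : ℕ) : ℚ))) = 0 :=
    qrBit_eq_zero_of_eq (p := p) 2 (-1 * 2 ^ 2 * q ^ 2) (by push_cast; ring)
      (by rw [jacobiSym.mul_left, jacobiSym.mul_left, jPm1, jP4, jPqq]; norm_num)
  -- the constants at `q`
  have kQ0 : qrBit q ((-((2 * (p * q) : ℕ) : ℚ) - 0) * (-((2 * (p * q) : ℕ) : ℚ) - ((2 * (p * q) : ℕ) : ℚ))) = 1 :=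
    qrBit_eq_one_of_eq (p := q) 2 (2 * 2 ^ 2 * p ^ 2) (by push_cast; ring)
      (by rw [jacobiSym.mul_left, jacobiSym.mul_left, jQ2, jQ4, jQpp]; norm_num)
  have kQ1 : qrBit q (-((2 * (p * q) : ℕ) : ℚ) - 0) = 1 :=
    qrBit_eq_one_of_eq (p := q) 1 (-1 * 2 * p) (by push_cast; ring)
      (by rw [jacobiSym.mul_left, jacobiSym.mul_left, jQm1, jQ2, hsym]; norm_num)
  have kQ2 : qrBit q ((0 : ℚ) - -((2 * (p * q) : ℕ) : ℚ)) = 0 :=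
    qrBit_eq_zero_of_eq (p := q) 1 (2 * p) (by push_cast; ring)
      (by rw [jacobiSym.mul_left, jQ2, hsym]; norm_num)
  have kQ3 : qrBit q (((0 : ℚ) - -((2 * (p * q) : ℕ) : ℚ)) * (0 - ((2 * (p * q) : ℕ) : ℚ))) = 1 :=
    qrBit_eq_one_of_eq (p := q) 2 (-1 * 2 ^ 2 * p ^ 2) (by push_cast; ring)
      (by rw [jacobiSym.mul_left, jacobiSym.mul_left, jQm1, jQ4, jQpp]; norm_num)
  -- the local conditions
  have hpos := pos_of_mem (p := p) (q := q) hT hc a ha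
  have hsa : signBit (a : ℚ) = 0 := (signBit_eq_zero_iff ha0).mpr hpos
  have hev : ∀ r : ℕ, r.Prime → r ≠ 2 → r ≠ p → r ≠ q →
      Even (padicValRat r (a : ℚ)) ∧ Even (padicValRat r (b : ℚ)) := fun r hr hr2 hrp hrq =>
    even_padicValRat_of_mem (p := p) (q := q) hT hp2 hq2 hpq hc a b ha hb hr hr2 hrp hrq
  have HP := qrBit_rel_of_mem (p := p) (q := q) hT hpr (Or.inl rfl) hp2 hq2 hpq hc a b ha hb
  have HQ := qrBit_rel_of_mem (p := p) (q := q) hT hqr (Or.inr rfl) hp2 hq2 hpq hc a b ha hb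
  rw [kP0, kP1, kP2, kP3] at HP
  rw [kQ0, kQ1, kQ2, kQ3] at HQ
  -- square-free kernel expansions of `qrBit p a`, `qrBit p b`, `qrBit q a`, `qrBit q b`
  have hl2q : ∀ x ∈ ([2, q] : List ℕ), x.Prime := by
    intro x hx
    simp only [List.mem_cons, List.not_mem_nil, or_false] at hx
    rcases hx with rfl | rfl
    exacts [Nat.prime_two, hqr]
  have hl2p : ∀ x ∈ ([2, p] : List ℕ), x.Prime := by
    intro x hx
    simp only [List.mem_cons, List.not_mem_nil, or_false] at hx
    rcases hx with rfl | rfl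
    exacts [Nat.prime_two, hpr]
  have BPa := qrBit_eq_signBit_add_listSum (p := p) ha0 [2, q] (by simp [Ne.symm hq2]) hl2q (by simp [hp2, hpq])
    (fun r hr hrl hrp => (hev r hr (fun h => hrl (by simp [h])) hrp (fun h => hrl (by simp [h]))).1)
  have BPb := qrBit_eq_signBit_add_listSum (p := p) hb0 [2, q] (by simp [Ne.symm hq2]) hl2q (by simp [hp2, hpq])
    (fun r hr hrl hrp => (hev r hr (fun h => hrl (by simp [h])) hrp (fun h => hrl (by simp [h]))).2)
  have BQa := qrBit_eq_signBit_add_listSum (p := q) ha0 [2, p] (by simp [Ne.symm hp2]) hl2p (by simp [hq2, hqp])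
    (fun r hr hrl hrq => (hev r hr (fun h => hrl (by simp [h])) (fun h => hrl (by simp [h])) hrq).1)
  have BQb := qrBit_eq_signBit_add_listSum (p := q) hb0 [2, p] (by simp [Ne.symm hp2]) hl2p (by simp [hq2, hqp])
    (fun r hr hrl hrq => (hev r hr (fun h => hrl (by simp [h])) (fun h => hrl (by simp [h])) hrq).2)
  simp only [List.map_cons, List.map_nil, List.sum_cons, List.sum_nil] at BPa BPb BQa BQb
  rw [hsa, cPm1, cP2, cPq] at BPa
  rw [cPm1, cP2, cPq] at BPb
  rw [hsa, cQm1, cQ2, cQp] at BQa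
  rw [cQm1, cQ2, cQp] at BQb
  rw [BPa, BPb] at HP
  rw [BQa, BQb] at HQ
  obtain ⟨HP1, HP2⟩ := HP
  obtain ⟨HQ1, HQ2⟩ := HQ
  simp only [mul_one, mul_zero, add_zero, zero_add] at HP1 HP2 HQ1 HQ2
  exact rows_one3 _ _ _ _ _ _ _ HP1 HP2 HQ1 HQ2

/-- **`#Sel⁽²⁾(E_{2pq}/ℚ) ≤ 8` for `p ≡ 1 (mod 8)`, `q ≡ 3 (mod 8)`, `(p/q) = −1`** by complete `2`-descent (places `p`,
`q`, `∞`). [cite: SilvermanAEC2009, Prop. X.1.4, Prop. X.4.9] [cite: Monsky1990MockHeegner, Remark (3) (p. 67)] -/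
theorem card_selmerGroup_two_le_eight_one_three (h8p : p % 8 = 1) (h8q : q % 8 = 3) (hsym : jacobiSym p q = -1) :
    Nat.card ((congruentNumberCurve (2 * (p * q))).selmerGroup 2) ≤ 8 := by
  have hp2 : p ≠ 2 := by rintro rfl; norm_num at h8p
  have hq2 : q ≠ 2 := by rintro rfl; norm_num at h8q
  have hpq : p ≠ q := by rintro rfl; omega
  haveI := isElliptic_congruentNumberCurve (two_mul_ne_zero' (p := p) (q := q))
  have hT := splitTwoTorsion_cn (2 * (p * q))
  set W := congruentNumberCurve (2 * (p * q)) with hW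
  obtain ⟨κ, hκ⟩ : ∃ κ : (Fin 7 → ZMod 2) →+ (Fin 4 → ZMod 2),
      κ = (Matrix.mulVecLin (!![0, 1, 1, 0, 0, 0, 0; 0, 0, 0, 0, 0, 1, 1; 1, 1, 0, 0, 0, 0, 1;
        0, 0, 1, 1, 1, 1, 1] : Matrix (Fin 4) (Fin 7) (ZMod 2))).toAddMonoidHom := ⟨_, rfl⟩
  have hsurj : Function.Surjective κ := by rw [hκ]; exact κ_one3_surjective
  -- the two components and the seven coordinates, as additive maps on `H¹(ℚ, E[2])`
  obtain ⟨F₁, hF₁⟩ : ∃ F₁ : galH1Torsion W 2 →+ Additive (SqUnits ℚ),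
      ∀ c, F₁ c = kummerEquiv ℚ 2 (W.twoTorsionCharH1 hT c) :=
    ⟨(kummerEquiv ℚ 2).toAddMonoidHom.comp (W.twoTorsionCharH1 hT), fun c => rfl⟩
  obtain ⟨F₂, hF₂⟩ : ∃ F₂ : galH1Torsion W 2 →+ Additive (SqUnits ℚ),
      ∀ c, F₂ c = kummerEquiv ℚ 2 (W.twoTorsionCharH1 hT.swap₁₂ c) :=
    ⟨(kummerEquiv ℚ 2).toAddMonoidHom.comp (W.twoTorsionCharH1 hT.swap₁₂), fun c => rfl⟩
  obtain ⟨ψ, hψ⟩ : ∃ ψ : galH1Torsion W 2 →+ (Fin 7 → ZMod 2), ∀ c,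
      ψ c = ![parityHom 2 (F₁ c), parityHom p (F₁ c), parityHom q (F₁ c), signHom (F₂ c),
        parityHom 2 (F₂ c), parityHom p (F₂ c), parityHom q (F₂ c)] :=
    ⟨AddMonoidHom.pi fun i => (![(parityHom 2).comp F₁, (parityHom p).comp F₁, (parityHom q).comp F₁,
        signHom.comp F₂, (parityHom 2).comp F₂, (parityHom p).comp F₂, (parityHom q).comp F₂] :
          Fin 7 → (galH1Torsion W 2 →+ ZMod 2)) i,
      fun c => by ext i; fin_cases i <;> rfl⟩
  -- representatives and the value of `ψ` on them
  have hrep : ∀ c : galH1Torsion W 2, ∃ a b : ℚˣ,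
      kummerEquiv ℚ 2 (W.twoTorsionCharH1 hT c) = Additive.ofMul (QuotientGroup.mk a) ∧
      kummerEquiv ℚ 2 (W.twoTorsionCharH1 hT.swap₁₂ c) = Additive.ofMul (QuotientGroup.mk b) ∧
      ψ c = ![parityBit 2 (a : ℚ), parityBit p (a : ℚ), parityBit q (a : ℚ), signBit (b : ℚ),
        parityBit 2 (b : ℚ), parityBit p (b : ℚ), parityBit q (b : ℚ)] := by
    intro c
    obtain ⟨a, ha⟩ := QuotientGroup.mk_surjective (Additive.toMul (F₁ c))
    obtain ⟨b, hb⟩ := QuotientGroup.mk_surjective (Additive.toMul (F₂ c))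
    have ha' : F₁ c = Additive.ofMul (QuotientGroup.mk a) := by rw [ha, ofMul_toMul]
    have hb' : F₂ c = Additive.ofMul (QuotientGroup.mk b) := by rw [hb, ofMul_toMul]
    refine ⟨a, b, (hF₁ c).symm.trans ha', (hF₂ c).symm.trans hb', ?_⟩
    rw [hψ c, ha', hb', mk_eq_sqClass, mk_eq_sqClass, parityHom_sqClass a.ne_zero,
      parityHom_sqClass a.ne_zero, parityHom_sqClass a.ne_zero, signHom_sqClass b.ne_zero,
      parityHom_sqClass b.ne_zero, parityHom_sqClass b.ne_zero, parityHom_sqClass b.ne_zero]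
  -- `ψ` maps the Selmer group into `ker κ`, injectively
  have hkill : ∀ c : W.selmerGroup 2, ψ (c : galH1Torsion W 2) ∈ κ.ker := fun c => by
    obtain ⟨a, b, ha, hb, hψc⟩ := hrep c
    rw [AddMonoidHom.mem_ker, hψc, hκ]
    exact kill_selmer_one3 hT h8p h8q hsym c.2 a b ha hb
  let f : W.selmerGroup 2 → κ.ker := fun c => ⟨ψ (c : galH1Torsion W 2), hkill c⟩
  have hf : Function.Injective f := by
    intro c₁ c₂ h12
    have h12' : ψ (c₁ : galH1Torsion W 2) = ψ (c₂ : galH1Torsion W 2) := congrArg Subtype.val h12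
    have hsub : ψ ((c₁ : galH1Torsion W 2) - c₂) = 0 := by rw [map_sub, h12', sub_self]
    obtain ⟨a, b, ha, hb, hψc⟩ := hrep ((c₁ : galH1Torsion W 2) - c₂)
    rw [hψc] at hsub
    have e0 := congr_fun hsub 0
    have e1 := congr_fun hsub 1
    have e2 := congr_fun hsub 2
    have e3 := congr_fun hsub 3
    have e4 := congr_fun hsub 4
    have e5 := congr_fun hsub 5
    have e6 := congr_fun hsub 6
    simp only [Matrix.cons_val_zero, Matrix.cons_val_one, Matrix.cons_val, Pi.zero_apply] at e0 e1 e2 e3 e4 e5 e6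
    have := eq_zero_of_coords_eq_zero hT hp2 hq2 hpq (sub_mem c₁.2 c₂.2) a b ha hb e0 e1 e2 e3 e4 e5 e6
    exact Subtype.ext (sub_eq_zero.mp this)
  have hcard : Nat.card (W.selmerGroup 2) ≤ Nat.card κ.ker := Nat.card_le_card_of_injective f hf
  have hker := natCard_ker_of_surjective κ hsurj
  have h8 : Nat.card κ.ker = 8 := by
    have h16 : (2 : ℕ) ^ 4 = 16 := by norm_num
    have h128 : (2 : ℕ) ^ 7 = 128 := by norm_num
    rw [h16, h128] at hker
    omega
  rw [h8] at hcard
  exact hcard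

/-! ## The four linear relations on the cell `p ≡ 1 (mod 8)`, `q ≡ 7 (mod 8)`, `(p/q) = −1` -/

set_option synthInstance.maxSize 100000 in
set_option synthInstance.maxHeartbeats 400000 in
/-- **The four relations annihilate the coordinates**: `a_q = a_p`, `b_q = b_p`, `s + b_p = a_q`, `a₂ = s + b_q + b₂`.
[folklore] -/
private theorem rows_one7 (a2 ap aq s b2 bp bq : ZMod 2) (P1 : aq = ap) (P2 : bq = bp)
    (Q2 : s + bp = aq) (H2 : a2 = s + bq + b2) :
    (Matrix.mulVecLin (!![0, 1, 1, 0, 0, 0, 0; 0, 0, 0, 0, 0, 1, 1; 0, 0, 1, 1, 0, 1, 0;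
      1, 0, 0, 1, 1, 0, 1] : Matrix (Fin 4) (Fin 7) (ZMod 2))).toAddMonoidHom ![a2, ap, aq, s, b2, bp, bq] = 0 := by
  revert P1 P2 Q2 H2 a2 ap aq s b2 bp bq
  decide

/-- An explicit preimage: the matrix of the four relations is onto `(ℤ/2)⁴`. [folklore] -/
private theorem κ_one7_apply_pivot : ∀ (w : Fin 4 → ZMod 2),
    (Matrix.mulVecLin (!![0, 1, 1, 0, 0, 0, 0; 0, 0, 0, 0, 0, 1, 1; 0, 0, 1, 1, 0, 1, 0;
      1, 0, 0, 1, 1, 0, 1] : Matrix (Fin 4) (Fin 7) (ZMod 2))).toAddMonoidHom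
        ![w 3 + w 2 + w 0 + w 1, 0, w 0, w 2 + w 0, 0, 0, w 1] = w := by
  decide

omit hp hq in
/-- The matrix of the four relations is surjective. [folklore] -/
private theorem κ_one7_surjective : Function.Surjective
    (Matrix.mulVecLin (!![0, 1, 1, 0, 0, 0, 0; 0, 0, 0, 0, 0, 1, 1; 0, 0, 1, 1, 0, 1, 0;
      1, 0, 0, 1, 1, 0, 1] : Matrix (Fin 4) (Fin 7) (ZMod 2))).toAddMonoidHom := fun w =>
  ⟨![w 3 + w 2 + w 0 + w 1, 0, w 0, w 2 + w 0, 0, 0, w 1], κ_one7_apply_pivot w⟩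

/-! ## The descent on Selmer classes, `p ≡ 1 (mod 8)`, `q ≡ 7 (mod 8)`, `(p/q) = −1` -/

/-- **The four relations hold on `Sel⁽²⁾(E_{2pq}/ℚ)`** for `p ≡ 1 (mod 8)`, `q ≡ 7 (mod 8)`, `(p/q) = −1` (the fourth one
`2`-adic). [cite: SilvermanAEC2009, Example X.1.5] [cite: SilvermanAEC2009, Prop. X.1.4, Prop. X.4.9] -/
theorem kill_selmer_one7 (h8p : p % 8 = 1) (h8q : q % 8 = 7) (hsym : jacobiSym p q = -1)
    {c : galH1Torsion (congruentNumberCurve (2 * (p * q))) 2}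
    (hc : c ∈ (congruentNumberCurve (2 * (p * q))).selmerGroup 2) (a b : ℚˣ)
    (ha : kummerEquiv ℚ 2 ((congruentNumberCurve (2 * (p * q))).twoTorsionCharH1 hT c) =
      Additive.ofMul (QuotientGroup.mk a))
    (hb : kummerEquiv ℚ 2 ((congruentNumberCurve (2 * (p * q))).twoTorsionCharH1 hT.swap₁₂ c) =
      Additive.ofMul (QuotientGroup.mk b))
    :
    (Matrix.mulVecLin (!![0, 1, 1, 0, 0, 0, 0; 0, 0, 0, 0, 0, 1, 1; 0, 0, 1, 1, 0, 1, 0;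
      1, 0, 0, 1, 1, 0, 1] : Matrix (Fin 4) (Fin 7) (ZMod 2))).toAddMonoidHom
      ![parityBit 2 (a : ℚ), parityBit p (a : ℚ), parityBit q (a : ℚ), signBit (b : ℚ), parityBit 2 (b : ℚ),
        parityBit p (b : ℚ), parityBit q (b : ℚ)] = 0 := by
  have h4q : q % 4 = 3 := by omega
  have hp2 : p ≠ 2 := by rintro rfl; norm_num at h8p
  have hq2 : q ≠ 2 := by rintro rfl; norm_num at h4q
  have hpq : p ≠ q := by rintro rfl; omega
  have hqp : q ≠ p := Ne.symm hpq
  have hpr : p.Prime := hp.out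
  have hqr : q.Prime := hq.out
  have hp0 : (p : ℚ) ≠ 0 := Nat.cast_ne_zero.mpr hpr.ne_zero
  have hq0 : (q : ℚ) ≠ 0 := Nat.cast_ne_zero.mpr hqr.ne_zero
  have ha0 : (a : ℚ) ≠ 0 := a.ne_zero
  have hb0 : (b : ℚ) ≠ 0 := b.ne_zero
  -- the symbols: `(2/p) = +1`, `(−1/p) = 1`, `(2/q) = +1`, `(−1/q) = −1`, `(q/p) = (p/q) = −1`
  have jP2 := jac_two_eq_one (p := p) (Or.inl h8p)
  have jQ2 := jac_two_eq_one (p := q) (Or.inr h8q)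
  have jPm1 := jac_neg_one_of_one_mod_four (p := p) (by omega)
  have jQm1 := jac_neg_one_of_three_mod_four' (p := q) h4q
  have gqp := gcd_q_p' (p := p) (q := q) hpq
  have gpq := gcd_q_p' (p := q) (q := p) hqp
  have jP4 : jacobiSym ((2 : ℤ) ^ 2) p = 1 := jacobiSym.sq_one' (gcd_two_p' (p := p) hp2)
  have jQ4 : jacobiSym ((2 : ℤ) ^ 2) q = 1 := jacobiSym.sq_one' (gcd_two_p' (p := q) hq2)
  have jPqq : jacobiSym ((q : ℤ) ^ 2) p = 1 := jacobiSym.sq_one' gqp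
  have jQpp : jacobiSym ((p : ℤ) ^ 2) q = 1 := jacobiSym.sq_one' gpq
  have hQR : jacobiSym (p : ℤ) q = jacobiSym (q : ℤ) p :=
    jacobiSym.quadratic_reciprocity_one_mod_four (by omega) (Nat.odd_iff.mpr (by omega))
  have jPq : jacobiSym (q : ℤ) p = -1 := hQR ▸ hsym
  -- values of `qrBit` on the symbols
  have cPm1 : qrBit p ((-1 : ℚ)) = 0 := qrBit_eq_zero_of_eq (p := p) 0 (-1) (by norm_num) jPm1
  have cP2 : qrBit p (((2 : ℕ) : ℚ)) = 0 := qrBit_eq_zero_of_eq (p := p) 0 (2) (by norm_num) jP2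
  have cPq : qrBit p ((q : ℕ) : ℚ) = 1 := qrBit_eq_one_of_eq (p := p) 0 (q) (by norm_num) jPq
  have cQm1 : qrBit q ((-1 : ℚ)) = 1 := qrBit_eq_one_of_eq (p := q) 0 (-1) (by norm_num) jQm1
  have cQ2 : qrBit q (((2 : ℕ) : ℚ)) = 0 := qrBit_eq_zero_of_eq (p := q) 0 (2) (by norm_num) jQ2
  have cQp : qrBit q ((p : ℕ) : ℚ) = 1 := qrBit_eq_one_of_eq (p := q) 0 (p) (by norm_num) hsym
  -- the constants at `p`
  have kP0 : qrBit p ((-((2 * (p * q) : ℕ) : ℚ) - 0) * (-((2 * (p * q) : ℕ) : ℚ) - ((2 * (p * q) : ℕ) : ℚ))) = 0 :=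
    qrBit_eq_zero_of_eq (p := p) 2 (2 * 2 ^ 2 * q ^ 2) (by push_cast; ring)
      (by rw [jacobiSym.mul_left, jacobiSym.mul_left, jP2, jP4, jPqq]; norm_num)
  have kP1 : qrBit p (-((2 * (p * q) : ℕ) : ℚ) - 0) = 1 :=
    qrBit_eq_one_of_eq (p := p) 1 (-1 * 2 * q) (by push_cast; ring)
      (by rw [jacobiSym.mul_left, jacobiSym.mul_left, jPm1, jP2, jPq]; norm_num)
  have kP2 : qrBit p ((0 : ℚ) - -((2 * (p * q) : ℕ) : ℚ)) = 1 :=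
    qrBit_eq_one_of_eq (p := p) 1 (2 * q) (by push_cast; ring)
      (by rw [jacobiSym.mul_left, jP2, jPq]; norm_num)
  have kP3 : qrBit p (((0 : ℚ) - -((2 * (p * q) : ℕ) : ℚ)) * (0 - ((2 * (p * q) : ℕ) : ℚ))) = 0 :=
    qrBit_eq_zero_of_eq (p := p) 2 (-1 * 2 ^ 2 * q ^ 2) (by push_cast; ring)
      (by rw [jacobiSym.mul_left, jacobiSym.mul_left, jPm1, jP4, jPqq]; norm_num)
  -- the constants at `q`
  have kQ0 : qrBit q ((-((2 * (p * q) : ℕ) : ℚ) - 0) * (-((2 * (p * q) : ℕ) : ℚ) - ((2 * (p * q) : ℕ) : ℚ))) = 0 :=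
    qrBit_eq_zero_of_eq (p := q) 2 (2 * 2 ^ 2 * p ^ 2) (by push_cast; ring)
      (by rw [jacobiSym.mul_left, jacobiSym.mul_left, jQ2, jQ4, jQpp]; norm_num)
  have kQ1 : qrBit q (-((2 * (p * q) : ℕ) : ℚ) - 0) = 0 :=
    qrBit_eq_zero_of_eq (p := q) 1 (-1 * 2 * p) (by push_cast; ring)
      (by rw [jacobiSym.mul_left, jacobiSym.mul_left, jQm1, jQ2, hsym]; norm_num)
  have kQ2 : qrBit q ((0 : ℚ) - -((2 * (p * q) : ℕ) : ℚ)) = 1 :=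
    qrBit_eq_one_of_eq (p := q) 1 (2 * p) (by push_cast; ring)
      (by rw [jacobiSym.mul_left, jQ2, hsym]; norm_num)
  have kQ3 : qrBit q (((0 : ℚ) - -((2 * (p * q) : ℕ) : ℚ)) * (0 - ((2 * (p * q) : ℕ) : ℚ))) = 1 :=
    qrBit_eq_one_of_eq (p := q) 2 (-1 * 2 ^ 2 * p ^ 2) (by push_cast; ring)
      (by rw [jacobiSym.mul_left, jacobiSym.mul_left, jQm1, jQ4, jQpp]; norm_num)
  -- the local conditions
  have hpos := pos_of_mem (p := p) (q := q) hT hc a ha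
  have hsa : signBit (a : ℚ) = 0 := (signBit_eq_zero_iff ha0).mpr hpos
  have hev : ∀ r : ℕ, r.Prime → r ≠ 2 → r ≠ p → r ≠ q →
      Even (padicValRat r (a : ℚ)) ∧ Even (padicValRat r (b : ℚ)) := fun r hr hr2 hrp hrq =>
    even_padicValRat_of_mem (p := p) (q := q) hT hp2 hq2 hpq hc a b ha hb hr hr2 hrp hrq
  have HP := qrBit_rel_of_mem (p := p) (q := q) hT hpr (Or.inl rfl) hp2 hq2 hpq hc a b ha hb
  have HQ := qrBit_rel_of_mem (p := p) (q := q) hT hqr (Or.inr rfl) hp2 hq2 hpq hc a b ha hb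
  rw [kP0, kP1, kP2, kP3] at HP
  rw [kQ0, kQ1, kQ2, kQ3] at HQ
  -- the `2`-adic relation
  have hm : Odd ((p : ℤ) * q) :=
    Int.odd_mul.mpr ⟨(Int.odd_coe_nat p).mpr (hpr.odd_of_ne_two hp2), (Int.odd_coe_nat q).mpr (hqr.odd_of_ne_two hq2)⟩
  have H2 := (congruentNumberCurve (2 * (p * q))).parityBit_two_eq_of_mem_selmerGroup_cn hm
    (n := ((2 * (p * q) : ℕ) : ℚ)) (by push_cast; ring) hT hc a b ha hb
  have C2 := chi4_eq_signBit_add_listSum hb0 [p, q] (by simp [hpq])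
    (by
      intro x hx
      simp only [List.mem_cons, List.not_mem_nil, or_false] at hx
      rcases hx with rfl | rfl
      exacts [hpr, hqr])
    (by simp [Ne.symm hp2, Ne.symm hq2])
    (fun r hr hrl hr2 => (hev r hr hr2 (fun h => hrl (by simp [h])) (fun h => hrl (by simp [h]))).2)
  simp only [List.map_cons, List.map_nil, List.sum_cons, List.sum_nil] at C2
  have k2_p : chi4 (((p : ℕ) : ℚ)) = 0 := chi4_eq_zero_of_eq 0 (p) (by norm_num) (by omega)
  have k2_q : chi4 (((q : ℕ) : ℚ)) = 1 := chi4_eq_one_of_eq 0 (q) (by norm_num) (by omega)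
  have k2_m : chi4 (((p : ℤ) * q : ℤ) : ℚ) = 1 := by
    refine chi4_eq_one_of_eq 0 ((p : ℤ) * q) (by norm_num) ?_
    have hp4 : (p : ℤ) % 4 = 1 := by omega
    have hq4 : (q : ℤ) % 4 = 3 := by omega
    rw [Int.mul_emod, hp4, hq4]; norm_num
  rw [chi4_neg_one, k2_p, k2_q] at C2
  rw [C2, k2_m] at H2
  -- square-free kernel expansions of `qrBit p a`, `qrBit p b`, `qrBit q a`, `qrBit q b`
  have hl2q : ∀ x ∈ ([2, q] : List ℕ), x.Prime := by
    intro x hx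
    simp only [List.mem_cons, List.not_mem_nil, or_false] at hx
    rcases hx with rfl | rfl
    exacts [Nat.prime_two, hqr]
  have hl2p : ∀ x ∈ ([2, p] : List ℕ), x.Prime := by
    intro x hx
    simp only [List.mem_cons, List.not_mem_nil, or_false] at hx
    rcases hx with rfl | rfl
    exacts [Nat.prime_two, hpr]
  have BPa := qrBit_eq_signBit_add_listSum (p := p) ha0 [2, q] (by simp [Ne.symm hq2]) hl2q (by simp [hp2, hpq])
    (fun r hr hrl hrp => (hev r hr (fun h => hrl (by simp [h])) hrp (fun h => hrl (by simp [h]))).1)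
  have BPb := qrBit_eq_signBit_add_listSum (p := p) hb0 [2, q] (by simp [Ne.symm hq2]) hl2q (by simp [hp2, hpq])
    (fun r hr hrl hrp => (hev r hr (fun h => hrl (by simp [h])) hrp (fun h => hrl (by simp [h]))).2)
  have BQa := qrBit_eq_signBit_add_listSum (p := q) ha0 [2, p] (by simp [Ne.symm hp2]) hl2p (by simp [hq2, hqp])
    (fun r hr hrl hrq => (hev r hr (fun h => hrl (by simp [h])) (fun h => hrl (by simp [h])) hrq).1)
  have BQb := qrBit_eq_signBit_add_listSum (p := q) hb0 [2, p] (by simp [Ne.symm hp2]) hl2p (by simp [hq2, hqp])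
    (fun r hr hrl hrq => (hev r hr (fun h => hrl (by simp [h])) (fun h => hrl (by simp [h])) hrq).2)
  simp only [List.map_cons, List.map_nil, List.sum_cons, List.sum_nil] at BPa BPb BQa BQb
  rw [hsa, cPm1, cP2, cPq] at BPa
  rw [cPm1, cP2, cPq] at BPb
  rw [hsa, cQm1, cQ2, cQp] at BQa
  rw [cQm1, cQ2, cQp] at BQb
  rw [BPa, BPb] at HP
  rw [BQa, BQb] at HQ
  obtain ⟨HP1, HP2⟩ := HP
  obtain ⟨-, HQ2⟩ := HQ
  simp only [mul_one, mul_zero, add_zero, zero_add, one_mul] at HP1 HP2 HQ2 H2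
  exact rows_one7 _ _ _ _ _ _ _ HP1 HP2 HQ2 H2

/-- **`#Sel⁽²⁾(E_{2pq}/ℚ) ≤ 8` for `p ≡ 1 (mod 8)`, `q ≡ 7 (mod 8)`, `(p/q) = −1`** by complete `2`-descent with the
`2`-adic place. [cite: SilvermanAEC2009, Prop. X.1.4, Example X.1.5, Prop. X.4.9] [cite: Monsky1990MockHeegner, Remark (3) (p. 67)] -/
theorem card_selmerGroup_two_le_eight_one_seven (h8p : p % 8 = 1) (h8q : q % 8 = 7) (hsym : jacobiSym p q = -1) :
    Nat.card ((congruentNumberCurve (2 * (p * q))).selmerGroup 2) ≤ 8 := by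
  have hp2 : p ≠ 2 := by rintro rfl; norm_num at h8p
  have hq2 : q ≠ 2 := by rintro rfl; norm_num at h8q
  have hpq : p ≠ q := by rintro rfl; omega
  haveI := isElliptic_congruentNumberCurve (two_mul_ne_zero' (p := p) (q := q))
  have hT := splitTwoTorsion_cn (2 * (p * q))
  set W := congruentNumberCurve (2 * (p * q)) with hW
  obtain ⟨κ, hκ⟩ : ∃ κ : (Fin 7 → ZMod 2) →+ (Fin 4 → ZMod 2),
      κ = (Matrix.mulVecLin (!![0, 1, 1, 0, 0, 0, 0; 0, 0, 0, 0, 0, 1, 1; 0, 0, 1, 1, 0, 1, 0;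
        1, 0, 0, 1, 1, 0, 1] : Matrix (Fin 4) (Fin 7) (ZMod 2))).toAddMonoidHom := ⟨_, rfl⟩
  have hsurj : Function.Surjective κ := by rw [hκ]; exact κ_one7_surjective
  -- the two components and the seven coordinates, as additive maps on `H¹(ℚ, E[2])`
  obtain ⟨F₁, hF₁⟩ : ∃ F₁ : galH1Torsion W 2 →+ Additive (SqUnits ℚ),
      ∀ c, F₁ c = kummerEquiv ℚ 2 (W.twoTorsionCharH1 hT c) :=
    ⟨(kummerEquiv ℚ 2).toAddMonoidHom.comp (W.twoTorsionCharH1 hT), fun c => rfl⟩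
  obtain ⟨F₂, hF₂⟩ : ∃ F₂ : galH1Torsion W 2 →+ Additive (SqUnits ℚ),
      ∀ c, F₂ c = kummerEquiv ℚ 2 (W.twoTorsionCharH1 hT.swap₁₂ c) :=
    ⟨(kummerEquiv ℚ 2).toAddMonoidHom.comp (W.twoTorsionCharH1 hT.swap₁₂), fun c => rfl⟩
  obtain ⟨ψ, hψ⟩ : ∃ ψ : galH1Torsion W 2 →+ (Fin 7 → ZMod 2), ∀ c,
      ψ c = ![parityHom 2 (F₁ c), parityHom p (F₁ c), parityHom q (F₁ c), signHom (F₂ c),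
        parityHom 2 (F₂ c), parityHom p (F₂ c), parityHom q (F₂ c)] :=
    ⟨AddMonoidHom.pi fun i => (![(parityHom 2).comp F₁, (parityHom p).comp F₁, (parityHom q).comp F₁,
        signHom.comp F₂, (parityHom 2).comp F₂, (parityHom p).comp F₂, (parityHom q).comp F₂] :
          Fin 7 → (galH1Torsion W 2 →+ ZMod 2)) i,
      fun c => by ext i; fin_cases i <;> rfl⟩
  -- representatives and the value of `ψ` on them
  have hrep : ∀ c : galH1Torsion W 2, ∃ a b : ℚˣ,
      kummerEquiv ℚ 2 (W.twoTorsionCharH1 hT c) = Additive.ofMul (QuotientGroup.mk a) ∧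
      kummerEquiv ℚ 2 (W.twoTorsionCharH1 hT.swap₁₂ c) = Additive.ofMul (QuotientGroup.mk b) ∧
      ψ c = ![parityBit 2 (a : ℚ), parityBit p (a : ℚ), parityBit q (a : ℚ), signBit (b : ℚ),
        parityBit 2 (b : ℚ), parityBit p (b : ℚ), parityBit q (b : ℚ)] := by
    intro c
    obtain ⟨a, ha⟩ := QuotientGroup.mk_surjective (Additive.toMul (F₁ c))
    obtain ⟨b, hb⟩ := QuotientGroup.mk_surjective (Additive.toMul (F₂ c))
    have ha' : F₁ c = Additive.ofMul (QuotientGroup.mk a) := by rw [ha, ofMul_toMul]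
    have hb' : F₂ c = Additive.ofMul (QuotientGroup.mk b) := by rw [hb, ofMul_toMul]
    refine ⟨a, b, (hF₁ c).symm.trans ha', (hF₂ c).symm.trans hb', ?_⟩
    rw [hψ c, ha', hb', mk_eq_sqClass, mk_eq_sqClass, parityHom_sqClass a.ne_zero,
      parityHom_sqClass a.ne_zero, parityHom_sqClass a.ne_zero, signHom_sqClass b.ne_zero,
      parityHom_sqClass b.ne_zero, parityHom_sqClass b.ne_zero, parityHom_sqClass b.ne_zero]
  -- `ψ` maps the Selmer group into `ker κ`, injectively
  have hkill : ∀ c : W.selmerGroup 2, ψ (c : galH1Torsion W 2) ∈ κ.ker := fun c => by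
    obtain ⟨a, b, ha, hb, hψc⟩ := hrep c
    rw [AddMonoidHom.mem_ker, hψc, hκ]
    exact kill_selmer_one7 hT h8p h8q hsym c.2 a b ha hb
  let f : W.selmerGroup 2 → κ.ker := fun c => ⟨ψ (c : galH1Torsion W 2), hkill c⟩
  have hf : Function.Injective f := by
    intro c₁ c₂ h12
    have h12' : ψ (c₁ : galH1Torsion W 2) = ψ (c₂ : galH1Torsion W 2) := congrArg Subtype.val h12
    have hsub : ψ ((c₁ : galH1Torsion W 2) - c₂) = 0 := by rw [map_sub, h12', sub_self]
    obtain ⟨a, b, ha, hb, hψc⟩ := hrep ((c₁ : galH1Torsion W 2) - c₂)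
    rw [hψc] at hsub
    have e0 := congr_fun hsub 0
    have e1 := congr_fun hsub 1
    have e2 := congr_fun hsub 2
    have e3 := congr_fun hsub 3
    have e4 := congr_fun hsub 4
    have e5 := congr_fun hsub 5
    have e6 := congr_fun hsub 6
    simp only [Matrix.cons_val_zero, Matrix.cons_val_one, Matrix.cons_val, Pi.zero_apply] at e0 e1 e2 e3 e4 e5 e6
    have := eq_zero_of_coords_eq_zero hT hp2 hq2 hpq (sub_mem c₁.2 c₂.2) a b ha hb e0 e1 e2 e3 e4 e5 e6
    exact Subtype.ext (sub_eq_zero.mp this)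
  have hcard : Nat.card (W.selmerGroup 2) ≤ Nat.card κ.ker := Nat.card_le_card_of_injective f hf
  have hker := natCard_ker_of_surjective κ hsurj
  have h8 : Nat.card κ.ker = 8 := by
    have h16 : (2 : ℕ) ^ 4 = 16 := by norm_num
    have h128 : (2 : ℕ) ^ 7 = 128 := by norm_num
    rw [h16, h128] at hker
    omega
  rw [h8] at hcard
  exact hcard

end CongruentNumberTwicePrimePairSelmer

/-- **`#Sel⁽²⁾(E_{2pq}/ℚ) ≤ 8` for all primes `p ≡ 1 (mod 8)`, `q ≡ 3 (mod 4)` with `(p/q) = −1`** (instance-free; the loud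
`p ≡ 1 (mod 8)` cells of the `k = 2` rung of Monsky's even law). [cite: SilvermanAEC2009, Prop. X.1.4, Example X.1.5, Prop. X.4.9]
[cite: Monsky1990MockHeegner, Remark (3) (p. 67)] -/
theorem card_selmerGroup_two_le_eight_congruentNumberCurve_two_mul_one_mod_eight_of_jacobiSym_eq_neg_one {p q : ℕ}
    (hp : p.Prime) (hq : q.Prime) (h8p : p % 8 = 1) (h4q : q % 4 = 3) (hsym : jacobiSym p q = -1) :
    Nat.card ((congruentNumberCurve (2 * (p * q))).selmerGroup 2) ≤ 8 := by
  haveI : Fact p.Prime := ⟨hp⟩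
  haveI : Fact q.Prime := ⟨hq⟩
  rcases (show q % 8 = 3 ∨ q % 8 = 7 by omega) with h3 | h7
  · exact CongruentNumberTwicePrimePairSelmer.card_selmerGroup_two_le_eight_one_three h8p h3 hsym
  · exact CongruentNumberTwicePrimePairSelmer.card_selmerGroup_two_le_eight_one_seven h8p h7 hsym

end Literature.NumberTheory.EllipticCurves

end
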